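import Mathlib
import Summits.NavierStokesRegularity.NavierStokesRegularity.Theorems.TaoLadderRungTwoBreakBlowupRigidityOneNilpotentTables
import HarnessLib

/-!
# STRONGLY ABSORBING DEAD SETS: a cancelling table whose rotor, outflow and back-reaction all LAND in a set `D` of
  modes that cannot emit carries NO admissible eternal solution (any `ε₀`) — even when `D` contains a self-sustaining
  core (so the table need not be nilpotent); the classification stub of K2(1) `TaoLadderRungTwoBreak.BlowupRigidityOne`
  (stmt-NavierStokesRegularity-20206) is vacuous there (`--supports`)

MODEL lattice ODEs only (Tao 2016 §4 (4.1)–(4.3), Lemma 4.1 (iii) (4.8) in self-similar variables, §6.4); nothing here is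
a statement about the Navier–Stokes equations; NO item is closed.  DEF-FREE; ROUTE-INDEPENDENT.

THE CLASS (strongly absorbing dead set `D`):
  (L1) `α_{jk i,(0,0,1)} = 0` for all `j, k` and `i ∉ D`;  (L2) `α_{jk i,(0,0,1)} = 0` for `j, k ∈ D` and all `i`;
  (L3) `α_{jk i,(0,0,0)} = 0` for all `j, k` and `i ∉ D`;  (L4) `α_{jk i,(1,0,0)} = α_{jk i,(0,1,0)} = 0` for all `j, k`, `i ∉ D`.
(L1)–(L3) with `D 0 = univ` is the one-hop class of `…OneHopTables` (no robust blow-up); (L4) makes the modes outside `D`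
UNDRIVEN in every shell of an ETERNAL solution (which has no datum shell), so:

* `eternal_apply_eq_zero_of_undriven` — an undriven renormalised mode of an admissible eternal solution vanishes
  (`f' = −f` and the action clause);
* `eternal_dark_of_absorbing` — under (L1), (L3), (L4) every shell of an admissible eternal solution is supported in `D`;
* `norm_sq_eternal_of_absorbing`, `eternal_trivial_of_absorbing` — then by (L2) no shell emits, the shell energies obey
  `‖W_n(σ)‖² = ‖W_n(0)‖² e^{−2σ}` (feed and back-reaction do no work, `table_sTable`), and the action clause forces
  `W ≡ 0`;
* `not_eternalSurvivingFwd_of_absorbing`, `stubEternalIsDSS_on_absorbing` — no forward survival; the classification stub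
  holds vacuously on such tables at every `ε₀`.

HONEST LABEL: calibration of one aside leaf on an explicit sub-class; no stub, crux, rung or summit is proved; rung 0.
-/

noncomputable section

-- the summit and its single sub-problem share the name (CONVENTIONS §1)
set_option linter.dupNamespace false

open Set Filter Topology MeasureTheory
open scoped RealInnerProductSpace

namespace Summit.NavierStokesRegularity.NavierStokesRegularity.Theorems

namespace BlowupRigidityOne

open Literature.Analysis.FluidPDE Literature.Analysis.FluidPDE.TaoCascade
  Literature.Analysis.FluidPDE.Tao2016AveragedNS

variable {m : ℕ} {ε₀ : ℝ} {α : Fin m → Fin m → Fin m → ℤ × ℤ × ℤ → ℝ} {W : ℤ → ℝ → Em m}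

/-- **An undriven renormalised mode of an admissible eternal solution vanishes.**  If the driving forms of mode `i`
vanish identically along the solution (`[Q(W_n) + Λ A(W_{n−1}) + Λ⁻¹ B(W_{n+1}, W_n)]_i = 0` for all `σ`), then
`(W_n)_i' = −(W_n)_i`, so `(W_n)_i(σ) = (W_n)_i(0) e^{−σ}`, and the action clause forces `(W_n)_i ≡ 0`.
[cite: Tao2016AveragedNS, §4 Lemma 4.1 (iii) (4.8) in self-similar variables (§6.4); cell vocabulary (`IsEternal`, clause `action`)] -/
theorem eternal_apply_eq_zero_of_undriven (hW : IsEternal ε₀ α W) (n : ℤ) (i : Fin m)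
    (hR : ∀ σ, tableQ α (W n σ) i + bigLam ε₀ * tableA α (W (n - 1) σ) i
      + (bigLam ε₀)⁻¹ * tableB α (W (n + 1) σ) (W n σ) i = 0) : ∀ σ, W n σ i = 0 := by
  have hder : ∀ σ, HasDerivAt (fun σ => W n σ i) (-(W n σ i)) σ := by
    intro σ
    have h := hasDerivAt_apply_of_isEternal hW n σ i
    rw [hR σ, add_zero] at h
    exact h
  have hconst : ∀ σ, Real.exp σ * W n σ i = W n 0 i := by
    intro σ
    have hd : ∀ w, HasDerivAt (fun w => Real.exp w * W n w i) 0 w := by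
      intro w
      have h1 := (Real.hasDerivAt_exp w).mul (hder w)
      have e : Real.exp w * W n w i + Real.exp w * -(W n w i) = 0 := by ring
      rw [e] at h1
      exact h1
    have h := is_const_of_deriv_eq_zero (f := fun w => Real.exp w * W n w i)
      (fun w => (hd w).differentiableAt) (fun w => (hd w).deriv) σ 0
    simpa using h
  have hform : ∀ σ, W n σ i = W n 0 i * Real.exp (-σ) := by
    intro σ
    have h := hconst σ
    have hexp : Real.exp σ * Real.exp (-σ) = 1 := by rw [← Real.exp_add, add_neg_cancel, Real.exp_zero]
    calc W n σ i = Real.exp σ * W n σ i * Real.exp (-σ) := by rw [mul_comm (Real.exp σ), mul_assoc, hexp, mul_one]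
      _ = W n 0 i * Real.exp (-σ) := by rw [h]
  have h0 : W n 0 i = 0 := by
    by_contra hne
    obtain ⟨M, hM⟩ := hW.action
    have hint : Integrable (fun σ => W n σ i) := by
      refine (hM n).1.mono' ?_ (Eventually.of_forall fun σ => ?_)
      · exact (continuous_iff_continuousAt.2 fun σ => (hder σ).continuousAt).aestronglyMeasurable
      · rw [Real.norm_eq_abs]
        exact abs_apply_le_norm (W n σ) i
    have heq : (fun σ => W n σ i) = fun σ => W n 0 i * Real.exp (-σ) := funext hform
    rw [heq] at hint
    have hexp : Integrable (fun σ : ℝ => Real.exp (-σ)) := by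
      have := hint.const_mul ((W n 0 i)⁻¹)
      refine this.congr (Eventually.of_forall fun σ => ?_)
      simp only
      rw [← mul_assoc, inv_mul_cancel₀ hne, one_mul]
    exact not_integrable_exp_neg hexp
  intro σ
  rw [hform σ, h0, zero_mul]

/-- **The dark modes of an admissible eternal solution of a strongly absorbing table.**  Under (L1), (L3), (L4) every
mode `i ∉ D` is undriven in every shell, hence vanishes: every shell is supported in `D`.
[cite: Tao2016AveragedNS, §4 (4.1), Lemma 4.1 (iii) (4.8); cell vocabulary (strongly absorbing dead set)] -/
theorem eternal_dark_of_absorbing {D : Finset (Fin m)}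
    (hL1 : ∀ j k i, i ∉ D → α j k i ((0 : ℤ), (0 : ℤ), (1 : ℤ)) = 0)
    (hL3 : ∀ j k i, i ∉ D → α j k i ((0 : ℤ), (0 : ℤ), (0 : ℤ)) = 0)
    (hL4 : ∀ j k i, i ∉ D → α j k i ((1 : ℤ), (0 : ℤ), (0 : ℤ)) = 0 ∧ α j k i ((0 : ℤ), (1 : ℤ), (0 : ℤ)) = 0)
    (hW : IsEternal ε₀ α W) : ∀ n σ i, i ∉ D → W n σ i = 0 := by
  intro n σ i hi
  refine eternal_apply_eq_zero_of_undriven hW n i (fun σ => ?_) σ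
  have hQ : tableQ α (W n σ) i = 0 := by
    simp only [tableQ_apply, qform]
    exact Finset.sum_eq_zero fun j _ => Finset.sum_eq_zero fun k _ => by rw [hL3 j k i hi, zero_mul]
  have hA : tableA α (W (n - 1) σ) i = 0 := by
    simp only [tableA_apply, qform]
    exact Finset.sum_eq_zero fun j _ => Finset.sum_eq_zero fun k _ => by rw [hL1 j k i hi, zero_mul]
  have hB : tableB α (W (n + 1) σ) (W n σ) i = 0 := by
    simp only [tableB_apply, qform]
    rw [Finset.sum_eq_zero fun j _ => Finset.sum_eq_zero fun k _ => by rw [(hL4 j k i hi).1, zero_mul],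
      Finset.sum_eq_zero fun j _ => Finset.sum_eq_zero fun k _ => by rw [(hL4 j k i hi).2, zero_mul], add_zero]
  rw [hQ, hA, hB, mul_zero, mul_zero, add_zero, add_zero]

/-- **Energy identity on a strongly absorbing table.**  Under (L1)–(L4) every shell of an admissible eternal solution is
`D`-supported (`eternal_dark_of_absorbing`), so no shell emits (`A(W_n) = 0` by (L2)); then feed and back-reaction do no
work and `‖W_n(σ)‖² = ‖W_n(0)‖² e^{−2σ}` (intra-shell neutrality and `⟪x, B(y,x)⟫ = −⟪y, A x⟫`, `table_sTable`).
[cite: Tao2016AveragedNS, §4 (4.3), Lemma 4.1 (iii) (4.8) in self-similar variables; cell vocabulary (`IsEternal`)] -/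
theorem norm_sq_eternal_of_absorbing (hc : IsCancellingCoeff α) {D : Finset (Fin m)}
    (hL1 : ∀ j k i, i ∉ D → α j k i ((0 : ℤ), (0 : ℤ), (1 : ℤ)) = 0)
    (hL2 : ∀ j k i, j ∈ D → k ∈ D → α j k i ((0 : ℤ), (0 : ℤ), (1 : ℤ)) = 0)
    (hL3 : ∀ j k i, i ∉ D → α j k i ((0 : ℤ), (0 : ℤ), (0 : ℤ)) = 0)
    (hL4 : ∀ j k i, i ∉ D → α j k i ((1 : ℤ), (0 : ℤ), (0 : ℤ)) = 0 ∧ α j k i ((0 : ℤ), (1 : ℤ), (0 : ℤ)) = 0)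
    (hW : IsEternal ε₀ α W) (n : ℤ) (σ : ℝ) :
    ‖W n σ‖ ^ 2 = ‖W n 0‖ ^ 2 * Real.exp (-(2 * σ)) := by
  have hST := table_sTable α hc
  have hdark := eternal_dark_of_absorbing hL1 hL3 hL4 hW
  have hAW : ∀ k z, tableA α (W k z) = 0 := fun k z =>
    tableA_eq_zero_of_supported hL2 fun i hi => hdark k z i hi
  have hder : ∀ z, HasDerivAt (fun z => ‖W n z‖ ^ 2) (-(2 * ‖W n z‖ ^ 2)) z := by
    intro z
    have h := (hW.law n z).norm_sq
    have hin : ⟪W n z, -((1 : ℝ) • W n z) + tableQ α (W n z)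
        + bigLam ε₀ • tableA α (W (n - 1) z)
        + (bigLam ε₀)⁻¹ • tableB α (W (n + 1) z) (W n z)⟫ = -‖W n z‖ ^ 2 := by
      rw [inner_add_right, inner_add_right, inner_add_right, inner_neg_right, inner_smul_right,
        inner_smul_right, inner_smul_right, real_inner_self_eq_norm_sq, hST.intra, hAW (n - 1) z, inner_zero_right]
      have hB : ⟪W n z, tableB α (W (n + 1) z) (W n z)⟫ = 0 := by
        have h2 := hST.cancel (W n z) (W (n + 1) z)
        rw [hAW n z, inner_zero_right, zero_add] at h2
        exact h2
      rw [hB]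
      ring
    rw [hin] at h
    convert h using 1
    ring
  have hconst : ∀ z, Real.exp (2 * z) * ‖W n z‖ ^ 2 = ‖W n 0‖ ^ 2 := by
    intro z
    have hd : ∀ w, HasDerivAt (fun w => Real.exp (2 * w) * ‖W n w‖ ^ 2) 0 w := by
      intro w
      have he : HasDerivAt (fun w => Real.exp (2 * w)) (Real.exp (2 * w) * 2) w := by
        have := (hasDerivAt_id w).const_mul (2 : ℝ)
        simp only [mul_one] at this
        exact (Real.hasDerivAt_exp (2 * w)).comp w this
      have h1 := he.mul (hder w)
      have e : Real.exp (2 * w) * 2 * ‖W n w‖ ^ 2 + Real.exp (2 * w) * (-(2 * ‖W n w‖ ^ 2)) = 0 := by ring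
      rw [e] at h1
      exact h1
    have h := is_const_of_deriv_eq_zero (f := fun w => Real.exp (2 * w) * ‖W n w‖ ^ 2)
      (fun w => (hd w).differentiableAt) (fun w => (hd w).deriv) z 0
    simpa using h
  have h := hconst σ
  have hexp : Real.exp (2 * σ) * Real.exp (-(2 * σ)) = 1 := by
    rw [← Real.exp_add, add_neg_cancel, Real.exp_zero]
  calc ‖W n σ‖ ^ 2 = Real.exp (2 * σ) * ‖W n σ‖ ^ 2 * Real.exp (-(2 * σ)) := by
        rw [mul_comm (Real.exp (2 * σ)), mul_assoc, hexp, mul_one]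
    _ = ‖W n 0‖ ^ 2 * Real.exp (-(2 * σ)) := by rw [h]

/-- **NO NON-TRIVIAL ADMISSIBLE ETERNAL SOLUTION ON A TABLE WITH A STRONGLY ABSORBING DEAD SET** ((L1)–(L4), cancelling,
any `ε₀`): by `norm_sq_eternal_of_absorbing` each shell has mass `‖W_n(0)‖e^{−σ}`, which the action clause excludes
unless `W_n(0) = 0`.  This class contains non-nilpotent tables (`D` may host a rotor core), complementing
`eternal_trivial_of_nilpotent`.
[cite: Tao2016AveragedNS, §4 (4.3), Lemma 4.1 (iii) (4.8); cell vocabulary (`IsEternal`, clause `action`)] -/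
theorem eternal_trivial_of_absorbing (hc : IsCancellingCoeff α) {D : Finset (Fin m)}
    (hL1 : ∀ j k i, i ∉ D → α j k i ((0 : ℤ), (0 : ℤ), (1 : ℤ)) = 0)
    (hL2 : ∀ j k i, j ∈ D → k ∈ D → α j k i ((0 : ℤ), (0 : ℤ), (1 : ℤ)) = 0)
    (hL3 : ∀ j k i, i ∉ D → α j k i ((0 : ℤ), (0 : ℤ), (0 : ℤ)) = 0)
    (hL4 : ∀ j k i, i ∉ D → α j k i ((1 : ℤ), (0 : ℤ), (0 : ℤ)) = 0 ∧ α j k i ((0 : ℤ), (1 : ℤ), (0 : ℤ)) = 0)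
    (hW : IsEternal ε₀ α W) : ∀ n σ, W n σ = 0 := by
  intro n
  have h0 : ‖W n 0‖ = 0 := by
    by_contra hne
    obtain ⟨M, hM⟩ := hW.action
    have hint : Integrable (fun σ => ‖W n σ‖) := (hM n).1
    have heq : (fun σ => ‖W n σ‖) = fun σ => ‖W n 0‖ * Real.exp (-σ) := by
      funext σ
      have hsq := norm_sq_eternal_of_absorbing hc hL1 hL2 hL3 hL4 hW n σ
      have hrhs : ‖W n 0‖ ^ 2 * Real.exp (-(2 * σ)) = (‖W n 0‖ * Real.exp (-σ)) ^ 2 := by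
        have h2 : Real.exp (-(2 * σ)) = Real.exp (-σ) ^ 2 := by
          rw [sq, ← Real.exp_add]
          exact congrArg Real.exp (by ring)
        rw [h2, mul_pow]
      rw [hrhs] at hsq
      exact (pow_left_inj₀ (norm_nonneg _) (by positivity) two_ne_zero).1 hsq
    rw [heq] at hint
    have hexp : Integrable (fun σ : ℝ => Real.exp (-σ)) := by
      have := hint.const_mul (‖W n 0‖⁻¹)
      refine this.congr (Eventually.of_forall fun σ => ?_)
      simp only
      rw [← mul_assoc, inv_mul_cancel₀ hne, one_mul]
    exact not_integrable_exp_neg hexp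
  intro σ
  have hsq := norm_sq_eternal_of_absorbing hc hL1 hL2 hL3 hL4 hW n σ
  rw [h0] at hsq
  simp only [ne_eq, OfNat.ofNat_ne_zero, not_false_eq_true, zero_pow, zero_mul] at hsq
  exact norm_eq_zero.1 (pow_eq_zero_iff two_ne_zero |>.1 hsq)

/-- **No forward survival on a table with a strongly absorbing dead set** (any `a`, any `ε₀`).
[cite: Tao2016AveragedNS, §4 (4.8), §6.4; cell vocabulary (`IsEternal`, `EternalSurvivingFwd`)] -/
theorem not_eternalSurvivingFwd_of_absorbing (hc : IsCancellingCoeff α) {D : Finset (Fin m)}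
    (hL1 : ∀ j k i, i ∉ D → α j k i ((0 : ℤ), (0 : ℤ), (1 : ℤ)) = 0)
    (hL2 : ∀ j k i, j ∈ D → k ∈ D → α j k i ((0 : ℤ), (0 : ℤ), (1 : ℤ)) = 0)
    (hL3 : ∀ j k i, i ∉ D → α j k i ((0 : ℤ), (0 : ℤ), (0 : ℤ)) = 0)
    (hL4 : ∀ j k i, i ∉ D → α j k i ((1 : ℤ), (0 : ℤ), (0 : ℤ)) = 0 ∧ α j k i ((0 : ℤ), (1 : ℤ), (0 : ℤ)) = 0)
    (hW : IsEternal ε₀ α W) (a : ℝ) : ¬ EternalSurvivingFwd a ε₀ W := by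
  rintro ⟨c, hc0, H⟩
  obtain ⟨n, -, σ, -, hle⟩ := H 0
  rw [eternal_trivial_of_absorbing hc hL1 hL2 hL3 hL4 hW n σ, norm_zero] at hle
  simp only [ne_eq, OfNat.ofNat_ne_zero, not_false_eq_true, zero_pow, mul_zero] at hle
  exact absurd hle (not_le.2 hc0)

/-- **THE CLASSIFICATION STUB ON STRONGLY ABSORBING TABLES, EVERY `ε₀`** (vacuously).
[cite: Tao2016AveragedNS, §4 (4.8), §6.4; cell vocabulary (`stub_eternalIsDSS` of skeleton 9d85f4d387c689cd)] -/
theorem stubEternalIsDSS_on_absorbing (hc : IsCancellingCoeff α) {D : Finset (Fin m)}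
    (hL1 : ∀ j k i, i ∉ D → α j k i ((0 : ℤ), (0 : ℤ), (1 : ℤ)) = 0)
    (hL2 : ∀ j k i, j ∈ D → k ∈ D → α j k i ((0 : ℤ), (0 : ℤ), (1 : ℤ)) = 0)
    (hL3 : ∀ j k i, i ∉ D → α j k i ((0 : ℤ), (0 : ℤ), (0 : ℤ)) = 0)
    (hL4 : ∀ j k i, i ∉ D → α j k i ((1 : ℤ), (0 : ℤ), (0 : ℤ)) = 0 ∧ α j k i ((0 : ℤ), (1 : ℤ), (0 : ℤ)) = 0)
    (ε₀ : ℝ) (hex : ∃ W : ℤ → ℝ → Em m, IsEternal ε₀ α W ∧ EternalSurvivingFwd 1 ε₀ W) :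
    ∃ (q : ℕ) (π : Equiv.Perm (Fin q)) (T : ℝ) (Φ : Fin q → ℝ → Em m),
      IsDSSWave ε₀ α π T Φ ∧ Surviving 1 ε₀ T ∧ ∃ r x, Φ r x ≠ 0 := by
  obtain ⟨W, hW, hS⟩ := hex
  exact absurd hS (not_eternalSurvivingFwd_of_absorbing hc hL1 hL2 hL3 hL4 hW 1)

end BlowupRigidityOne

end Summit.NavierStokesRegularity.NavierStokesRegularity.Theorems

end
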